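import Literature.MathematicalPhysics.QuantumFieldTheory.Balaban1983to89.B10SectAGathering
import Summits.QuantumFields.Balaban3D.Carriers.Tower
import Summits.QuantumFields.Balaban3D.Proofs.Transport48

/-!
# `Summit.QuantumFields.Balaban3D.Proofs.Bound55Tower` — the step leaf `B10SectAGathering.Bound55` ((22) p. 261 / (48)–(49),
# (55), (58) pp. 267–270 of [Balaban1985UV3]) ON THE LANE'S TOWER `Carriers.TowerInput.towerWith`, REDUCED to ONE per-history
# fibre inequality («The integral (49)» ≤ the (55)·(58) factor, transported) plus the R-RN barrier pinning — lane
# `pub-balaban3d`, seat p4 (LEAF-LEDGER C1; rulings R-RN, R-48, R-MASS, R-DISP)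

HONEST FRAMING (lane PLAN.md §0, binding): see `…Proofs.SectAFirstStep`.  The (β) displays (49) → (51) → (55) → (58) — the
saddle point around the background field, the chart `V′ = e^{iA′}`, the translation `A → g_kA`, the Gaussian normalisation
`log Z^{(k)}`, the cumulant remainder — are NOT proved here: they are, per new history `h′`, the single hypothesis `hfibre` below
(a lead-bookable NAMED RESIDUAL in the sense of R-DISP if no seat discharges it).  What IS kernel-checked: everything print does
in the paragraph p. 267 L33–p. 268 L13 («We apply the renormalization transformation T to the density ρ_k, and we use the inductive
inequality (41) … a sum of terms obtained by application of the renormalization transformation T … We introduce the decomposition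
of unity (7) … The first is simply the integral restricted to Z_k … it defines the first expression (48) … The second gives the
integral (49) …, which we have to calculate») over the lane's concrete tower: `T` applied to (41)_k (a.e. monotonicity), split
over the histories (a.e. additivity), the decomposition of unity inserted, the `Z_k`-part recognised as the next mass
(`Carriers.Masses.massRec_succ`, D-41′), and the passage from the dV-a.e. bound to the POINTWISE leaf through the version selection
of ruling R-RN.

WHAT THIS FILE PROVES (no `sorry`, axioms standard), for `D : Carriers.TowerInput S G`, `W := D.towerWith slot`, step `k`, step
pieces `P : StepPieces W.toTowerRun k`, a measurable Haar-compatible `Ū_k = (D.av k).avg`: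
* `transport_rho_le_lf_ae` — **(48)–(49) ⇒ (55)·(58), dV-a.e.**: from `B10.Ineq41 W.toTowerRun k`, decomposition-of-unity
  weights `w, χB` at scale `k` (`hcover`), the mass recursion (`hm₁`), integrability of the (41)_k summands, and `hfibre`:
  `T_k ρ_k ≤ LF_{k+1}(·)[(55)+(58) exponent]` dV-a.e. — the right-hand side of `Bound55 P` for the lane's `LF = Σ_h m·exp`;
* `bound55_of_select` — **`Bound55 P` BY NAME** from the a.e. bound and the ONE-SIDED selection spec of the run's upper barrier
  (`hsel : (T_kρ_k ≤ upper_k a.e.) → ρ_{k+1} ≤ upper_k` pointwise, seat p1's `Carriers.Run`/`RTSelect`) with the barrier PINNED to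
  the printed bound (`hupper : D.upper k = LF_{k+1}(·)[(55)+(58) exponent]`);
* `transport_lower_ae`, `bound55Lower_of_select` — the LOWER twin (LEAF-LEDGER C2, `Bound55Lower P`): from (47)_k, the
  trivial-history fibre inequality `hfibreLow` (the (β) content of p. 265 L21–28 / p. 272 L32–33) and the lower barrier pinned to
  `χ_{k+1}·exp[(57) exponent]`;
* `lower57_le_upper55` — the POINTWISE comparison `lower_k ≤ upper_k` of the pinned barriers (the `hlu` of the version selection),
  given the trivial-history mass `= 1` pointwise (an ask on seat p1's `histWeights3`) and `Rm_k ≥ 0`.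
-/

noncomputable section

namespace Summit.QuantumFields.Balaban3D.Proofs.Bound55Tower

open _root_.MeasureTheory
open Literature.MathematicalPhysics.QuantumFieldTheory.Balaban1983to89
open Literature.MathematicalPhysics.QuantumFieldTheory.Balaban1983to89.AveragingRT (rnTransport)
open Literature.MathematicalPhysics.QuantumFieldTheory.Balaban1983to89.B10SectAGathering (StepPieces Bound55 Bound55Lower)
open Literature.MathematicalPhysics.QuantumFieldTheory.Balaban1985CMP102
open Literature.MathematicalPhysics.QuantumFieldTheory.Balaban1985CMP102.Setting
open Summit.QuantumFields.Balaban3D.Carriers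
open Summit.QuantumFields.Balaban3D.Proofs.Transport48

variable {L : ℕ} {S : Scales L} {G : Type} [GaugeGroup G] [MeasurableSpace G] [HaarData G] [RegularGaugeGroup G]
  (D : TowerInput S G) (slot : ℕ → Prop) (k : ℕ)

/-- **(48)–(49) ⇒ the (55)·(58) bound, dV-a.e., on the lane's tower** (p. 267 L33–p. 268 L13 with (22)/(55)/(58); rulings R-RN,
R-48, R-MASS, D-41′).  `W = D.towerWith slot`; `(D.av k).avg` measurable and Haar-compatible; `w h′, χB h′ ∈ [0,1]` measurable
(the step weight of the decomposition of unity (7)–(8) at scale `k` and the small-field factor inside `B(Λ_{k+1}(h′))`) with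
some `h′ ↦ h` of full weight `w·χB ≥ 1` wherever `m_k(h) ≠ 0` (`hcover`); the masses of `D.W` dominate the transported weighted masses, `T_k[w(h′)·m_k(proj h′)] ≤
m_{k+1}(h′)` a.e. (`hm₁`: `Bound55Masses.histWeights3_transport_le_mass_ae` for `W := histWeights3 …`, `w := stepWeight …`); the (41)_k summands
are integrable; and `hfibre` — PER NEW HISTORY, «The integral (49)» ≤ `exp[(55)+(58) exponent]` in
transported form (THE (β) CONTENT of Sect. A (12)–(22) / Sect. C (50)–(58), not proved here).  THEN, given (41)_k
(`B10.Ineq41 W.toTowerRun k`): `T_k ρ_k ≤ W.LF (k+1) (·) [h′ ↦ −(1/g_k²)A^η(U_{k+1}) − E_k + (log σ₀ + d(𝔤) log g_k)|B(Λ_{k+1})*| +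
log Z^{(k)}(B(Λ_{k+1}),U_{k+1}) + Σ_jΣ𝒫_j + (the constants in (41)) + log Fl]` dV-a.e. — the right-hand side of LQB's `Bound55 P`.
[cite: Balaban1985UV3, (48)–(49) pp.267–268 + (55) p.269 + (58) p.270] -/
theorem transport_rho_le_lf_ae (P : StepPieces (D.towerWith slot).toTowerRun k)
    (havg : Measurable (D.av k).avg)
    (hmap : (fieldMeasure S.P k G).map (D.av k).avg = fieldMeasure S.P (k + 1) G)
    (w χB : Hist S.P (k + 1) → Density S.P k G)
    (hw : ∀ h', Measurable (w h')) (hw0 : ∀ h' U, 0 ≤ w h' U) (hw1 : ∀ h' U, w h' U ≤ 1)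
    (hχ : ∀ h', Measurable (χB h')) (hχ0 : ∀ h' U, 0 ≤ χB h' U) (hχ1 : ∀ h' U, χB h' U ≤ 1)
    (hcover : ∀ (h : Hist S.P k) (U : GaugeField S.P k G), D.W.mass k h U ≠ 0 →
      ∃ h' : Hist S.P (k + 1), h'.proj = h ∧ (1 : ℝ) ≤ w h' U * χB h' U)
    (hm₁ : ∀ h' : Hist S.P (k + 1), (rnTransport (D.av k).avg fun U => w h' U * D.W.mass k h'.proj U)
      ≤ᵐ[fieldMeasure S.P (k + 1) G] D.W.mass (k + 1) h')
    (hint : ∀ h : Hist S.P k, Integrable (fun U => D.W.mass k h U *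
      Real.exp (-((D.towerWith slot).mainT k h U) + D.Pint k h U - (D.towerWith slot).Ecst k
        + (D.towerWith slot).Zterm k h + (D.towerWith slot).Rm k)) (fieldMeasure S.P k G))
    (hfibre : ∀ h' : Hist S.P (k + 1),
      (rnTransport (D.av k).avg (fun U => w h' U * χB h' U * (D.W.mass k h'.proj U *
        Real.exp (-((D.towerWith slot).mainT k h'.proj U) + D.Pint k h'.proj U - (D.towerWith slot).Ecst k
          + (D.towerWith slot).Zterm k h'.proj + (D.towerWith slot).Rm k))))
      ≤ᵐ[fieldMeasure S.P (k + 1) G] fun V => rnTransport (D.av k).avg (fun U => w h' U * D.W.mass k h'.proj U) V *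
        Real.exp (-((D.towerWith slot).mainT (k + 1) h' V) - (D.towerWith slot).Ecst k
          + (P.logσ₀ + P.dg * Real.log (S.gk k)) * P.starB h' + P.logZU h' V + P.Pold h' V
          + (D.towerWith slot).Zterm k (P.proj h') + (D.towerWith slot).Rm k + P.logFl h' V))
    (h41 : B10.Ineq41 (D.towerWith slot).toTowerRun k) :
    ∀ᵐ V ∂(fieldMeasure S.P (k + 1) G), rnTransport (D.av k).avg ((D.towerWith slot).rho k) V ≤
      (D.towerWith slot).LF (k + 1) V (fun h' => -((D.towerWith slot).mainT (k + 1) h' V) - (D.towerWith slot).Ecst k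
          + (P.logσ₀ + P.dg * Real.log (S.gk k)) * P.starB h' + P.logZU h' V + P.Pold h' V
          + (D.towerWith slot).Zterm k (P.proj h') + (D.towerWith slot).Rm k + P.logFl h' V) := by
  have h41' : ∀ U : GaugeField S.P k G, (D.towerWith slot).rho k U ≤ ∑ h : Hist S.P k, D.W.mass k h U *
      Real.exp (-((D.towerWith slot).mainT k h U) + D.Pint k h U - (D.towerWith slot).Ecst k
        + (D.towerWith slot).Zterm k h + (D.towerWith slot).Rm k) := fun U => h41 U
  have hρ : Integrable ((D.towerWith slot).rho k) (fieldMeasure S.P k G) := run3_rho_integrable (D.toRunInput slot) k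
  have key := transport41_le_sum_ae havg hmap (Hist.proj (P := S.P) (k := k)) ((D.towerWith slot).rho k) hρ
    (D.W.mass k) (fun h U => -((D.towerWith slot).mainT k h U) + D.Pint k h U - (D.towerWith slot).Ecst k
        + (D.towerWith slot).Zterm k h + (D.towerWith slot).Rm k)
    w χB (D.W.mass (k + 1))
    (fun h' V => Real.exp (-((D.towerWith slot).mainT (k + 1) h' V) - (D.towerWith slot).Ecst k
          + (P.logσ₀ + P.dg * Real.log (S.gk k)) * P.starB h' + P.logZU h' V + P.Pold h' V
          + (D.towerWith slot).Zterm k (P.proj h') + (D.towerWith slot).Rm k + P.logFl h' V))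
    h41' hint (D.W.mass_nonneg k) hw hw0 hw1 hχ hχ0 hχ1 hcover hm₁ (fun _ _ => (Real.exp_pos _).le) hfibre
  exact key

/-- **`Bound55` BY NAME on the lane's tower, from the a.e. bound by version selection (ruling R-RN)**: if, in addition to the
hypotheses of `transport_rho_le_lf_ae`, the run's UPPER BARRIER at step `k` is PINNED to the printed bound (`hupper`:
`D.upper k = LF_{k+1}(·)[(55)+(58) exponent]`) and the run's transformation selects a version below the upper barrier whenever the
RN transport lies below it dV-a.e. (`hsel`, the one-sided selection `run3_rho_succ_le_upper`/`rtOpISelect_le_upper` of seat p1's `Carriers.Run`/`RTSelect`), then LQB's step leaf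
`B10SectAGathering.Bound55 P` holds for `W = D.towerWith slot` — (22) p. 261 at `k = 0`, (55)·(58) pp. 269–270 at `k ≥ 1`, modulo the
per-history fibre inequality `hfibre`. [cite: Balaban1985UV3, (22) p.261 + (55) p.269 + (58) p.270] -/
theorem bound55_of_select (P : StepPieces (D.towerWith slot).toTowerRun k)
    (havg : Measurable (D.av k).avg)
    (hmap : (fieldMeasure S.P k G).map (D.av k).avg = fieldMeasure S.P (k + 1) G)
    (w χB : Hist S.P (k + 1) → Density S.P k G)
    (hw : ∀ h', Measurable (w h')) (hw0 : ∀ h' U, 0 ≤ w h' U) (hw1 : ∀ h' U, w h' U ≤ 1)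
    (hχ : ∀ h', Measurable (χB h')) (hχ0 : ∀ h' U, 0 ≤ χB h' U) (hχ1 : ∀ h' U, χB h' U ≤ 1)
    (hcover : ∀ (h : Hist S.P k) (U : GaugeField S.P k G), D.W.mass k h U ≠ 0 →
      ∃ h' : Hist S.P (k + 1), h'.proj = h ∧ (1 : ℝ) ≤ w h' U * χB h' U)
    (hm₁ : ∀ h' : Hist S.P (k + 1), (rnTransport (D.av k).avg fun U => w h' U * D.W.mass k h'.proj U)
      ≤ᵐ[fieldMeasure S.P (k + 1) G] D.W.mass (k + 1) h')
    (hint : ∀ h : Hist S.P k, Integrable (fun U => D.W.mass k h U *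
      Real.exp (-((D.towerWith slot).mainT k h U) + D.Pint k h U - (D.towerWith slot).Ecst k
        + (D.towerWith slot).Zterm k h + (D.towerWith slot).Rm k)) (fieldMeasure S.P k G))
    (hfibre : ∀ h' : Hist S.P (k + 1),
      (rnTransport (D.av k).avg (fun U => w h' U * χB h' U * (D.W.mass k h'.proj U *
        Real.exp (-((D.towerWith slot).mainT k h'.proj U) + D.Pint k h'.proj U - (D.towerWith slot).Ecst k
          + (D.towerWith slot).Zterm k h'.proj + (D.towerWith slot).Rm k))))
      ≤ᵐ[fieldMeasure S.P (k + 1) G] fun V => rnTransport (D.av k).avg (fun U => w h' U * D.W.mass k h'.proj U) V *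
        Real.exp (-((D.towerWith slot).mainT (k + 1) h' V) - (D.towerWith slot).Ecst k
          + (P.logσ₀ + P.dg * Real.log (S.gk k)) * P.starB h' + P.logZU h' V + P.Pold h' V
          + (D.towerWith slot).Zterm k (P.proj h') + (D.towerWith slot).Rm k + P.logFl h' V))
    (hupper : ∀ V, D.upper k V =
      (D.towerWith slot).LF (k + 1) V (fun h' => -((D.towerWith slot).mainT (k + 1) h' V) - (D.towerWith slot).Ecst k
          + (P.logσ₀ + P.dg * Real.log (S.gk k)) * P.starB h' + P.logZU h' V + P.Pold h' V
          + (D.towerWith slot).Zterm k (P.proj h') + (D.towerWith slot).Rm k + P.logFl h' V))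
    (hsel : (∀ᵐ V ∂(fieldMeasure S.P (k + 1) G), rnTransport (D.av k).avg ((D.towerWith slot).rho k) V ≤ D.upper k V) →
      ∀ V, (D.towerWith slot).rho (k + 1) V ≤ D.upper k V) :
    Bound55 P := by
  intro h41 V
  have hae := transport_rho_le_lf_ae D slot k P havg hmap w χB hw hw0 hw1 hχ hχ0 hχ1 hcover hm₁ hint hfibre h41
  have hae' : ∀ᵐ V ∂(fieldMeasure S.P (k + 1) G),
      rnTransport (D.av k).avg ((D.towerWith slot).rho k) V ≤ D.upper k V := by
    filter_upwards [hae] with V hV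
    rw [hupper V]
    exact hV
  calc (D.towerWith slot).toTowerRun.ρ (k + 1) V = (D.towerWith slot).rho (k + 1) V := rfl
    _ ≤ D.upper k V := hsel hae' V
    _ = _ := hupper V

/-! ## The lower twin: (47)_k ⇒ the lower step bound (p. 265 L21–28 / p. 272 L32–33), same mechanism, trivial history only -/

/-- **The LOWER step bound, dV-a.e., on the lane's tower** (p. 265 L21–28 «Let us make a remark about a lower bound … we perform
the same operations on the whole lattice as on the sets Ω₁»; p. 272 L32–33 «The lower bound is proved in the same way, with all
simplifications coming from the fact that Ω_{k+1} = T_η»; ruling R-RN, R-DISP amendment 2): from (47)_k (`B10.Ineq47 W.toTowerRun k`),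
integrability of its left-hand side, and `hfibreLow` — the fibre inequality FOR THE TRIVIAL HISTORY in transported form,
`χ_{k+1}·exp[(57) exponent] ≤ T_k[χ_k·exp((47)_k exponent)]` dV-a.e. (THE (β) CONTENT, not proved here) — the left-hand side of
LQB's `Bound55Lower P` is `≤ T_k ρ_k` dV-a.e. (`T` monotone a.e.). [cite: Balaban1985UV3, p.265 L21–28 + (47) p.267 + p.272 L32–33] -/
theorem transport_lower_ae (P : StepPieces (D.towerWith slot).toTowerRun k)
    (havg : Measurable (D.av k).avg)
    (hmap : (fieldMeasure S.P k G).map (D.av k).avg = fieldMeasure S.P (k + 1) G)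
    (hint47 : Integrable (fun U => (D.towerWith slot).chi k U *
      Real.exp (-((D.towerWith slot).mainT k (Hist.triv S.P k) U) + D.Pint k (Hist.triv S.P k) U
        - (D.towerWith slot).Ecst k - (D.towerWith slot).Rm k)) (fieldMeasure S.P k G))
    (hfibreLow : (fun V => (D.towerWith slot).chi (k + 1) V *
        Real.exp (-((D.towerWith slot).mainT (k + 1) (Hist.triv S.P (k + 1)) V) - (D.towerWith slot).Ecst k
          + (P.logσ₀ + P.dg * Real.log (S.gk k)) * P.starB (Hist.triv S.P (k + 1)) + P.logZU (Hist.triv S.P (k + 1)) V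
          + P.Pold (Hist.triv S.P (k + 1)) V - (D.towerWith slot).Rm k + P.logFl (Hist.triv S.P (k + 1)) V))
      ≤ᵐ[fieldMeasure S.P (k + 1) G] rnTransport (D.av k).avg (fun U => (D.towerWith slot).chi k U *
        Real.exp (-((D.towerWith slot).mainT k (Hist.triv S.P k) U) + D.Pint k (Hist.triv S.P k) U
          - (D.towerWith slot).Ecst k - (D.towerWith slot).Rm k)))
    (h47 : B10.Ineq47 (D.towerWith slot).toTowerRun k) :
    ∀ᵐ V ∂(fieldMeasure S.P (k + 1) G), (D.towerWith slot).chi (k + 1) V *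
        Real.exp (-((D.towerWith slot).mainT (k + 1) (Hist.triv S.P (k + 1)) V) - (D.towerWith slot).Ecst k
          + (P.logσ₀ + P.dg * Real.log (S.gk k)) * P.starB (Hist.triv S.P (k + 1)) + P.logZU (Hist.triv S.P (k + 1)) V
          + P.Pold (Hist.triv S.P (k + 1)) V - (D.towerWith slot).Rm k + P.logFl (Hist.triv S.P (k + 1)) V)
      ≤ rnTransport (D.av k).avg ((D.towerWith slot).rho k) V := by
  have h47' : ∀ U : GaugeField S.P k G, (D.towerWith slot).chi k U *
      Real.exp (-((D.towerWith slot).mainT k (Hist.triv S.P k) U) + D.Pint k (Hist.triv S.P k) U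
        - (D.towerWith slot).Ecst k - (D.towerWith slot).Rm k) ≤ (D.towerWith slot).rho k U := fun U => h47 U
  have hρ : Integrable ((D.towerWith slot).rho k) (fieldMeasure S.P k G) := run3_rho_integrable (D.toRunInput slot) k
  have hmono := rnTransport_mono_ae (AvgAC.of_map_eq havg hmap) h47' hint47 hρ
  filter_upwards [hfibreLow, hmono] with V h1 h2
  exact h1.trans h2

/-- **`Bound55Lower` BY NAME on the lane's tower, from the a.e. bound by version selection (ruling R-RN)**: with the run's LOWER
BARRIER at step `k` PINNED to the printed lower bound (`hlower`: `D.lower k = χ_{k+1}·exp[(57) exponent]`) and the one-sided selection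
spec of the lower barrier (`hsel`), LQB's `B10SectAGathering.Bound55Lower P` holds for `W = D.towerWith slot`, modulo the trivial-history
fibre inequality `hfibreLow`. [cite: Balaban1985UV3, p.265 L21–28 + (47) p.267 + p.272 L32–33] -/
theorem bound55Lower_of_select (P : StepPieces (D.towerWith slot).toTowerRun k)
    (havg : Measurable (D.av k).avg)
    (hmap : (fieldMeasure S.P k G).map (D.av k).avg = fieldMeasure S.P (k + 1) G)
    (hint47 : Integrable (fun U => (D.towerWith slot).chi k U *
      Real.exp (-((D.towerWith slot).mainT k (Hist.triv S.P k) U) + D.Pint k (Hist.triv S.P k) U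
        - (D.towerWith slot).Ecst k - (D.towerWith slot).Rm k)) (fieldMeasure S.P k G))
    (hfibreLow : (fun V => (D.towerWith slot).chi (k + 1) V *
        Real.exp (-((D.towerWith slot).mainT (k + 1) (Hist.triv S.P (k + 1)) V) - (D.towerWith slot).Ecst k
          + (P.logσ₀ + P.dg * Real.log (S.gk k)) * P.starB (Hist.triv S.P (k + 1)) + P.logZU (Hist.triv S.P (k + 1)) V
          + P.Pold (Hist.triv S.P (k + 1)) V - (D.towerWith slot).Rm k + P.logFl (Hist.triv S.P (k + 1)) V))
      ≤ᵐ[fieldMeasure S.P (k + 1) G] rnTransport (D.av k).avg (fun U => (D.towerWith slot).chi k U *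
        Real.exp (-((D.towerWith slot).mainT k (Hist.triv S.P k) U) + D.Pint k (Hist.triv S.P k) U
          - (D.towerWith slot).Ecst k - (D.towerWith slot).Rm k)))
    (hlower : ∀ V, D.lower k V = (D.towerWith slot).chi (k + 1) V *
        Real.exp (-((D.towerWith slot).mainT (k + 1) (Hist.triv S.P (k + 1)) V) - (D.towerWith slot).Ecst k
          + (P.logσ₀ + P.dg * Real.log (S.gk k)) * P.starB (Hist.triv S.P (k + 1)) + P.logZU (Hist.triv S.P (k + 1)) V
          + P.Pold (Hist.triv S.P (k + 1)) V - (D.towerWith slot).Rm k + P.logFl (Hist.triv S.P (k + 1)) V))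
    (hsel : (∀ᵐ V ∂(fieldMeasure S.P (k + 1) G), D.lower k V ≤ rnTransport (D.av k).avg ((D.towerWith slot).rho k) V) →
      ∀ V, D.lower k V ≤ (D.towerWith slot).rho (k + 1) V) :
    Bound55Lower P := by
  intro h47 V
  have hae := transport_lower_ae D slot k P havg hmap hint47 hfibreLow h47
  have hae' : ∀ᵐ V ∂(fieldMeasure S.P (k + 1) G),
      D.lower k V ≤ rnTransport (D.av k).avg ((D.towerWith slot).rho k) V := by
    filter_upwards [hae] with V hV
    rw [hlower V]
    exact hV
  calc _ = D.lower k V := (hlower V).symm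
    _ ≤ (D.towerWith slot).rho (k + 1) V := hsel hae' V
    _ = (D.towerWith slot).toTowerRun.ρ (k + 1) V := rfl

/-! ## The pointwise barrier comparison `lower_k ≤ upper_k` (the `hlu` of seat p1's `run3_rho_succ_sandwich` / `run3_rho_succ_le_upper`) -/

omit [RegularGaugeGroup G] in
/-- **`lower57 ≤ upper55` POINTWISE** for the pinned barriers (ruling R-RN needs it for the version selection): the printed lower
step bound at the trivial history, `χ_{k+1}(V)·exp[(57) exponent]`, is below the printed upper bound `LF_{k+1}(V)[(55)+(58) exponent]`
— PROVIDED the trivial-history mass is `1` POINTWISE (`hmt`; print: Ω = T_η, nothing integrated — the RN version of seat p1's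
`histWeights3` is `1` only dV-a.e., so this is an ask on the carrier) and the remainder sum is non-negative (`hRm`; `rcoef ≥ 0`):
the exponents differ by `Zterm_k(triv) + 2·Rm_k = 2·Rm_k ≥ 0` (`TowerRun.Zterm_triv`, `StepPieces.proj_triv`) and `χ_{k+1} ≤ 1`.
[cite: Balaban1985UV3, (47) p.267 + p.272 L32–33] -/
theorem lower57_le_upper55 (P : StepPieces (D.towerWith slot).toTowerRun k)
    (hmt : ∀ V : GaugeField S.P (k + 1) G, D.W.mass (k + 1) (Hist.triv S.P (k + 1)) V = 1)
    (hRm : 0 ≤ (D.towerWith slot).Rm k) (V : GaugeField S.P (k + 1) G) :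
    (D.towerWith slot).chi (k + 1) V *
        Real.exp (-((D.towerWith slot).mainT (k + 1) (Hist.triv S.P (k + 1)) V) - (D.towerWith slot).Ecst k
          + (P.logσ₀ + P.dg * Real.log (S.gk k)) * P.starB (Hist.triv S.P (k + 1)) + P.logZU (Hist.triv S.P (k + 1)) V
          + P.Pold (Hist.triv S.P (k + 1)) V - (D.towerWith slot).Rm k + P.logFl (Hist.triv S.P (k + 1)) V)
      ≤ (D.towerWith slot).LF (k + 1) V (fun h' => -((D.towerWith slot).mainT (k + 1) h' V) - (D.towerWith slot).Ecst k
          + (P.logσ₀ + P.dg * Real.log (S.gk k)) * P.starB h' + P.logZU h' V + P.Pold h' V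
          + (D.towerWith slot).Zterm k (P.proj h') + (D.towerWith slot).Rm k + P.logFl h' V) := by
  have hχ1 : (D.towerWith slot).chi (k + 1) V ≤ 1 := by
    show chiSmall Set.univ ((D.toRunInput slot).ε₁ (k + 1)) V ≤ 1
    unfold chiSmall; split_ifs <;> norm_num
  have hproj : P.proj (Hist.triv S.P (k + 1)) = Hist.triv S.P k := P.proj_triv
  have hZ : (D.towerWith slot).Zterm k (Hist.triv S.P k) = 0 := (D.towerWith slot).toTowerRun.Zterm_triv k
  refine le_trans ?_ (mass_triv_mul_exp_le_lf D.W (k + 1) V _)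
  rw [hmt V]
  refine mul_le_mul hχ1 (Real.exp_le_exp.mpr ?_) (Real.exp_pos _).le zero_le_one
  rw [hproj, hZ]
  linarith

end Summit.QuantumFields.Balaban3D.Proofs.Bound55Tower

end
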